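import Summits.MatrixMultiplication.MatrixMultiplication.Theorems.LevelGradedCohnUmansLevelOneGL2DesignsTangencyNearThreeHalves
import Literature.Combinatorics.Extremal.PointLineInducedMatchingsProofs

/-!
# `stub_tangencySets` at every exponent `3/2 − ε`, UNCONDITIONALLY (wall-breaker axis `parabola lifts over finite
fields`, stub `stub_tangencySets` of the crux `LevelOneGL2Designs`, stmt-MatrixMultiplication-14080)

The stub asks for strong representative systems (SRS) of `AG(2,p)` — flags `(u_f, v_f)` with
`u_f ⬝ᵥ v_{f'} = 1 ↔ f = f'` — of size `c · p^{3/2}` along an unbounded set of primes.  The named fact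
`Literature.Combinatorics.Extremal.InducedMatchingsNearThreeHalves` (Pohoata, arXiv:2607.20422 (2026), Thm. 1.3:
`IM(2,q) ≳_r q^{3/2 − 2/(r−1)}` for primes `q ≡ ±1 (mod r)`, a parabola lift of the trace-zero slice of the real
cyclotomic integers) is now PROVED in the tree (`InducedMatchingsNearThreeHalves_holds`,
`Literature/Combinatorics/Extremal/PointLineInducedMatchingsProofs.lean`).  Feeding it to the conditional glue
`stubFormat_near_threeHalves_of_pohoata` of `…TangencyNearThreeHalves` gives the stub's exact flag format with
`p^{3/2}` replaced by `p^{3/2 − ε}`, for every `ε > 0`, with no hypothesis left: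

* `stubFormat_near_threeHalves` — `∀ ε > 0, ∃ c > 0, ∀ p₀, ∃ prime p ≥ p₀, ∃ S, c·p^{3/2−ε} ≤ |S| ∧ SRS(S)`;
* `stubFormat_near_threeHalves_progression` — the same along ALL sufficiently large primes of the two residue
  classes `±1 (mod r)` for a suitable prime `r = r(ε) ≥ 5` (so along a set of primes of positive Dirichlet density
  `2/(r−1)`), which is the form a consumer quantifying "for all large `p` in the family" needs.

So the axis settles the stub at every exponent below `3/2`; exponent exactly `3/2` (the stub as registered) is the
open frontier (no construction and no obstruction in print).  Elementary glue; no definitions.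
-/

-- the summit/problem path `MatrixMultiplication.MatrixMultiplication` is fixed by the tree layout (D-0017)
set_option linter.dupNamespace false

noncomputable section

open Finset Matrix

namespace Summit.MatrixMultiplication.MatrixMultiplication.Theorems.LevelOneGL2Designs.ParabolaLift

/-- **`stub_tangencySets` at exponent `3/2 − ε`, unconditionally.**  For every `ε > 0` there is `c > 0` such that
for every `p₀` some prime `p ≥ p₀` carries a strong representative system of `AG(2,p)` in the exact flag format of
`stub_tangencySets` with at least `c · p^{3/2 − ε}` flags.  (Pohoata 2026 Thm 1.3, proved in the tree as
`InducedMatchingsNearThreeHalves_holds`, fed to `stubFormat_near_threeHalves_of_pohoata`.)  The stub itself is the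
case `ε = 0`, which stays open. [Pohoata 2026, Thm 1.3 + elementary glue] -/
theorem stubFormat_near_threeHalves (ε : ℝ) (hε : 0 < ε) :
    ∃ c : ℝ, 0 < c ∧ ∀ p₀ : ℕ, ∃ (p : ℕ) (_ : Fact p.Prime), p₀ ≤ p ∧
      ∃ S : Finset ((Fin 2 → ZMod p) × (Fin 2 → ZMod p)),
        c * (p : ℝ) ^ (3 / 2 - ε : ℝ) ≤ S.card ∧
        ∀ f ∈ S, ∀ f' ∈ S, (dotProduct f.1 f'.2 = 1 ↔ f = f') :=
  stubFormat_near_threeHalves_of_pohoata Literature.Combinatorics.Extremal.InducedMatchingsNearThreeHalves_holds ε hε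

/-- **`stub_tangencySets` at exponent `3/2 − ε` along whole residue classes of primes.**  For every `ε > 0` there
are a prime `r ≥ 5`, a constant `c > 0` and a threshold `q₀` such that EVERY prime `p ≥ q₀` with
`p ≡ ±1 (mod r)` carries a strong representative system of `AG(2,p)` in the stub's flag format with at least
`c · p^{3/2 − ε}` flags.  (Choose `r` prime with `2/(r−1) ≤ ε`; Pohoata's tangency set of size
`c_r p^{3/2 − 2/(r−1)}` converts into flags with `FlagLine.TangencyHermitian.srs_of_tangencySet`, losing at most
the factor `1 − 1/p ≥ 1/2`.) [Pohoata 2026, Thm 1.3 + elementary glue] -/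
theorem stubFormat_near_threeHalves_progression (ε : ℝ) (hε : 0 < ε) :
    ∃ r : ℕ, r.Prime ∧ 5 ≤ r ∧ ∃ c : ℝ, 0 < c ∧ ∃ q₀ : ℕ, ∀ p : ℕ, p.Prime → q₀ ≤ p →
      (p % r = 1 ∨ p % r = r - 1) →
      ∃ S : Finset ((Fin 2 → ZMod p) × (Fin 2 → ZMod p)),
        c * (p : ℝ) ^ (3 / 2 - ε : ℝ) ≤ S.card ∧
        ∀ f ∈ S, ∀ f' ∈ S, (dotProduct f.1 f'.2 = 1 ↔ f = f') := by
  classical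
  -- a prime `r ≥ 5` with `2/(r-1) ≤ ε`
  obtain ⟨r, hr, hrp⟩ := Nat.exists_infinite_primes (max 5 (⌈2 / ε⌉₊ + 1))
  have hr5 : 5 ≤ r := le_trans (le_max_left _ _) hr
  have hrε : 2 / ((r : ℝ) - 1) ≤ ε := by
    have h1 : (⌈2 / ε⌉₊ : ℝ) + 1 ≤ r := by
      have := le_trans (le_max_right _ _) hr
      exact_mod_cast this
    have h2 : 2 / ε ≤ ⌈2 / ε⌉₊ := Nat.le_ceil _
    have h3 : 2 / ε ≤ (r : ℝ) - 1 := by linarith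
    have h4 : 0 < (r : ℝ) - 1 := by
      have : (5 : ℝ) ≤ r := by exact_mod_cast hr5
      linarith
    rw [div_le_iff₀ h4]
    rw [div_le_iff₀ hε] at h3
    linarith
  obtain ⟨c, hc, q₀, hq⟩ := Literature.Combinatorics.Extremal.InducedMatchingsNearThreeHalves_holds r hrp hr5
  refine ⟨r, hrp, hr5, c / 2, by positivity, q₀, fun p hp hq₀ hmod => ?_⟩
  haveI : Fact p.Prime := ⟨hp⟩
  obtain ⟨V, hV, htan⟩ := hq p hp hq₀ hmod
  -- choose the private lines and convert to the stub's flags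
  choose! u hu using htan
  obtain ⟨S, hS, hsrs⟩ := FlagLine.TangencyHermitian.srs_of_tangencySet V u (fun v hv => (hu v hv).1)
    (fun v hv => (hu v hv).2)
  refine ⟨S, ?_, hsrs⟩
  -- sizes: `|S| ≥ |V| (1 - 1/p) ≥ |V| / 2 ≥ (c/2) p^{3/2 - 2/(r-1)} ≥ (c/2) p^{3/2 - ε}`
  have hp2 : (2 : ℝ) ≤ p := by exact_mod_cast hp.two_le
  have hS' : (V.card : ℝ) * p ≤ S.card * p + V.card := by
    have := hS
    rw [ZMod.card] at this
    exact_mod_cast this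
  have hSV : (V.card : ℝ) ≤ 2 * S.card := by nlinarith
  have hp1 : (1 : ℝ) ≤ p := by linarith
  have hexp : (p : ℝ) ^ (3 / 2 - ε : ℝ) ≤ (p : ℝ) ^ ((3 : ℝ) / 2 - 2 / ((r : ℝ) - 1)) :=
    Real.rpow_le_rpow_of_exponent_le hp1 (by linarith)
  calc c / 2 * (p : ℝ) ^ (3 / 2 - ε : ℝ) ≤ c / 2 * (p : ℝ) ^ ((3 : ℝ) / 2 - 2 / ((r : ℝ) - 1)) := by
        gcongr
    _ = (c * (p : ℝ) ^ ((3 : ℝ) / 2 - 2 / ((r : ℝ) - 1))) / 2 := by ring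
    _ ≤ V.card / 2 := by gcongr
    _ ≤ S.card := by linarith

end Summit.MatrixMultiplication.MatrixMultiplication.Theorems.LevelOneGL2Designs.ParabolaLift
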